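import Summits.HodgeConjecture.HodgeConjecture.Theorems.LinearSystemTorelliTranscendentalOrSupportedStubOfMiddleOfPhantomGysin
import Literature.AlgebraicGeometry.HodgeTheory.PencilStepBelowMiddleHolds
import Summits.HodgeConjecture.HodgeConjecture.Theorems.LinearSystemTorelliAssembly
import Summits.HodgeConjecture.HodgeConjecture.Theorems.LimitExtensionDivisorInduction
import Summits.HodgeConjecture.HodgeConjecture.Theorems.LinearSystemTorelliHardLefschetzReduction
import Literature.AlgebraicGeometry.HodgeTheory.ComplexGysinCorrespondence
import Literature.AlgebraicGeometry.HodgeTheory.SupportedHodgeClassDescent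
import Literature.AlgebraicGeometry.HodgeTheory.ComplexOrientationCycleClassFacts
import Literature.AlgebraicGeometry.HodgeTheory.AlgebraicClassesHodgeTypeHolds
import Literature.AlgebraicGeometry.HodgeTheory.GysinFormalismHodgeOfGysin
import Summits.HodgeConjecture.HodgeConjecture.Theorems.LinearSystemTorelliTranscendentalOrSupportedStubResidueNecessary

/-!
# Crux `TranscendentalOrSupported` (stmt-HodgeConjecture-10853), line `HodgeEffectivity`:
# the crux from `MiddleDivisorSupport` (item 1081) and Hodge effectivity (Voisin's Conj. 4.7), and back

Route `LinearSystemTorelli`, crux `TranscendentalOrSupported` = GHC(2p, coniveau 1) in Grothendieck's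
sub-Hodge form. This file lands the COMPOSITION of the line `HodgeEffectivity`
(`Cruxes/TranscendentalOrSupported/Lines/HodgeEffectivity.lean`, crux-strategist p1 / lead c5) as the
registered assembly stub

* `stub_transcendentalOrSupported_of_middle_of_hodgeEffective :
    MiddleDivisorSupport → HodgeEffective → TranscendentalOrSupported`,

where `HodgeEffective` (written out; it is the registered stub `stub_hodgeEffective` of the line) is
Voisin's Conjecture 4.7 (J. Open Math. Probl. 1 (2025) §4.2) for the coniveau-1 phantom constituents
of `H²ᵖ(X^{2p})` in the Hodge-CORRESPONDENCE form of her Lemma 2.9: every irreducible rationally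
spanned sub-Hodge structure `W ⊆ H²ᵖ(X(ℂ); ℂ)` of rank `≥ 2` without `(2p,0)`-part lies in the sum of
the images of the actions `κ_* = pr_{X*}(pr_Y^*(–) ∪ κ) : Hᵃ(Y(ℂ); ℂ) → H²ᵖ(X(ℂ); ℂ)` (`corrAction`)
of RATIONAL classes `κ ∈ H^{2e}((X ⊗ Y)(ℂ); ℂ)` of HODGE TYPE `(e,e)`, over all smooth projective `Y`
(any dimension `m`), all orientation families, all degrees `a + 2e = 2p + 2m` with `e ≥ m + 1`.

Proof (Voisin's Prop. 4.8 on the tree's real carriers). The Hodge conjecture follows from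
`MiddleDivisorSupport` ALONE (`hodgeConjecture_of_middleDivisorSupport`): the CLOSED assembly item
1085 (`linearSystemTorelli_assembly_proof`) fed with the theorems `nonempty_hodgeModel_holds` (item
1943), `linearSystemTorelli_divisorInduction_proof` (item 1082),
the tree's unconditional pencil step `mem_algebraicClasses_of_two_mul_le` (= item 1083
`PencilReduction`, landed with this line as `linearSystemTorelli_pencilReduction_proof`) and
`linearSystemTorelli_hardLefschetzReduction_proof` (item 1084). Under HC every rational Hodge class
`κ` of type `(e,e)` on `X ⊗ Y` is algebraic, `κ ∈ Nᵉ H^{2e}(X ⊗ Y)`, so it dies off one closed `Z` of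
codimension `≥ e ≥ m + 1` (`exists_isClosed_of_mem_supportedClasses`); `pr_Y^* c ∪ κ` dies off `Z`
(`cupProduct_map`), and its Gysin image under `pr_X` (relative dimension `m`) is supported in
codimension `≥ e - m ≥ 1` (`complexGysin_mem_supportedClasses`; Poincaré duality
`OrientationFamily.hasPoincareDuality` and `gysinMap_restrictCompl_eq_zero_of_field ℂ` are theorems):
`corrAction_mem_supportedClasses_of_hodgeConjecture`,
`hodgeCorrespondences_le_supportedClasses_of_hodgeConjecture`. Then the landed induction engine
`isotypic_le_supportedClasses_of_ingredients` (p117181: semisimple splitting `stub_completelyReducible`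
+ polarizability, Hodge lines `stub_rankOne` supported by `MiddleDivisorSupport`, phantoms by
`HodgeEffective` + the above) gives `W ≤ N¹ H²ᵖ(X)`.

Converse (TIGHTNESS, `hodgeEffective_of_transcendentalOrSupported`): the crux implies `HodgeEffective`
granted Deligne's Cor. 8.2.8 (`N¹ = G¹`, named fact
`Deligne1974_ker_restrictCompl_eq_iSup_range_complexGysin`, through the landed
`residue_supportedClasses_le_iSupGysin`), because a Gysin map `g_* : Hᵃ(Y) → H²ᵖ(X)` (`dim Y < 2p`)
IS the action of the rational Hodge class `(g, 𝟙)_* 1 ∈ H^{4p}((X ⊗ Y)(ℂ); ℂ)`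
(`corrAction_gysinGraph_one_two`). So, modulo one classical theorem,
crux = `MiddleDivisorSupport` ∧ `HodgeEffective` = HC ∧ Conj 4.7(2p, 1).

ABSTRACT FORM (skeleton v3). With the landed bridge `stub_hodgeEffective_of_abstract` (Voisin I
Lemma 11.41 on the carriers, `…StubHodgeEffectiveOfAbstract.lean`) the same holds with Hodge
effectivity in its Hodge-STRUCTURE form `HodgeEffectiveAbstract` (the registered stub
`stub_hodgeEffectiveAbstract`: `W` lies in the sum of the images of the rational Hodge-structure
morphisms `Hᵃ(Y(ℂ)) → H²ᵖ(X(ℂ))` of bidegree `(r, r)`, `r ≥ 1`, from smooth projective `Y`):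
`MiddleDivisorSupport → HodgeEffectiveAbstract → TranscendentalOrSupported` (the glue for the split
{item 1081, HodgeEffectiveAbstract}; landed separately as the registered abstract assembly stub
`stub_transcendentalOrSupported_of_middle_of_hodgeEffectiveAbstract`, file
`…StubOfMiddleOfHodgeEffectiveAbstract.lean`, two lines from this file and the bridge) and its
converse modulo Deligne 8.2.8. So crux = HC ∧ Conj 4.7(2p,1) with Conj 4.7 stated in its own terms.

Also recorded: `TranscendentalOrSupported_of_subs`, the three-hypothesis glue
`MiddleDivisorSupport → PencilReduction → HodgeEffective → TranscendentalOrSupported` of the strategist's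
split kit (`Lines/HodgeEffectivity_split.md`; its `PencilReduction` hypothesis is now a theorem and
unused).

References: C. Voisin, J. Open Math. Probl. 1 (2025) 16–51, Lemma 2.9, Conj. 4.6–4.7, Prop. 4.8;
A. Grothendieck, Topology 8 (1969) 299–303; R. Thomas, J. Algebraic Geom. 14 (2005), Thm. 1, Prop. 2;
P. Deligne, Théorie de Hodge III, Publ. IHÉS 44 (1974), Cor. 8.2.8; W. Fulton, Intersection Theory,
§16.1 and App. B.
-/

noncomputable section

set_option linter.dupNamespace false

open CategoryTheory MonoidalCategory CartesianMonoidalCategory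
open Literature.AlgebraicGeometry.Motives Literature.AlgebraicGeometry.HodgeTheory
open Literature.AlgebraicTopology.SingularHomology

namespace Summit.HodgeConjecture.HodgeConjecture.Theorems

/-! ### The Hodge conjecture from `MiddleDivisorSupport` alone -/

/-- **The Hodge conjecture from the route's single open reduction item `MiddleDivisorSupport`**
(item 1081): the CLOSED assembly item 1085 (`linearSystemTorelli_assembly_proof`: strong induction on
the dimension, inner induction on the codimension) fed with the theorems `nonempty_hodgeModel_holds`
(item 1943), `linearSystemTorelli_divisorInduction_proof` (item 1082), the tree's unconditional
pencil step `mem_algebraicClasses_of_two_mul_le` (= item 1083 `PencilReduction`, closed by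
`linearSystemTorelli_pencilReduction_proof`, p137428; written inline here) and
`linearSystemTorelli_hardLefschetzReduction_proof` (item 1084). (Thomas 2005 Thm. 1: HC for the middle
cohomology of even-dimensional varieties, in divisor-support form, is the whole Hodge conjecture.)
[cite: Thomas2005Nodes, Thm. 1 and Prop. 2] [cite: DecataldoMigliorini2009, §4 Prop. 4.5] -/
theorem hodgeConjecture_of_middleDivisorSupport
    (hMid : Summit.HodgeConjecture.HodgeConjecture.Theses.LinearSystemTorelli.MiddleDivisorSupport) :
    _root_.HodgeConjecture :=
  linearSystemTorelli_assembly_proof (fun _ _ ↦ nonempty_hodgeModel_holds)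
    linearSystemTorelli_divisorInduction_proof
    -- `PencilReduction` (item 1083; landed as `linearSystemTorelli_pencilReduction_proof`, p137428):
    -- the tree's unconditional pencil step, its codimension-(p-1) hypothesis unused
    (fun _ p _ hpm hHC _ _ hX c hc hpp ↦ mem_algebraicClasses_of_two_mul_le hX hHC p c hpm hc hpp)
    linearSystemTorelli_hardLefschetzReduction_proof hMid

/-! ### Hodge correspondences act into `N¹` under the Hodge conjecture (Voisin 2025, Prop. 4.8) -/

/-- **Under the Hodge conjecture, a rational Hodge class `κ` of type `(e,e)` on `X ⊗ Y`
(`dim X = n`, `dim Y = m`, `e ≥ m + s`) acts `Hᵃ(Y(ℂ)) → Hᵇ(X(ℂ))` INTO `Nˢ Hᵇ(X)`** (Voisin 2025,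
proof of Prop. 4.8): HC puts `κ` in `algebraicClasses (X ⊗ Y) e = Nᵉ H^{2e}`, so `κ` dies off one
closed `Z` of codimension `≥ e` (`exists_isClosed_of_mem_supportedClasses`); `pr_Y^* c ∪ κ` dies off
`Z` too (`cupProduct_map`), and `pr_{X*}` of a class supported in codimension `≥ e` on the
`(n + m)`-fold `X ⊗ Y` is supported in codimension `≥ e - m` on `X`
(`complexGysin_mem_supportedClasses`, with the theorems `gysinMap_restrictCompl_eq_zero_of_field ℂ`
and `OrientationFamily.hasPoincareDuality`).
[cite: Voisin2025, Prop. 4.8 (proof)] [cite: Fulton1998, App. B] -/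
theorem corrAction_mem_supportedClasses_of_hodgeConjecture (hHC : _root_.HodgeConjecture)
    (μ : OrientationFamily) {n m : ℕ} {X Y : SchemeOver ℂ} (hX : IsSmoothProjective n X)
    (hY : IsSmoothProjective m Y) {a e b s : ℕ} (hab : a + 2 * e = b + 2 * m) (he : m + s ≤ e)
    {κ : complexBetti (X ⊗ Y) (2 * e)} (hκ : IsRationalClass κ)
    (hκt : IsOfHodgeType (n + m) (X ⊗ Y) (2 * e) e e κ) (c : complexBetti Y a) :
    corrAction μ hX hY hab κ c ∈ supportedClasses X b s := by
  have hκalg : κ ∈ supportedClasses (X ⊗ Y) (2 * e) e :=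
    (hHC (IsSmoothProjective.tensor_holds hX hY)).2 e κ hκ hκt
  obtain ⟨Z, hZcl, hZcod, hκZ⟩ := exists_isClosed_of_mem_supportedClasses hκalg
  rw [corrAction_apply]
  refine complexGysin_mem_supportedClasses (gysinMap_restrictCompl_eq_zero_of_field ℂ) μ
    μ.hasPoincareDuality (IsSmoothProjective.tensor_holds hX hY) hX (fst X Y) _ (r := e) (s := s)
    (by omega) ?_
  refine mem_supportedClasses_of_restrictCompl_eq_zero hZcl hZcod ?_
  rw [complexBetti.restrictCompl, cupProduct_map]
  rw [complexBetti.restrictCompl] at hκZ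
  rw [hκZ, map_zero]

/-- **Under the Hodge conjecture the whole supremum of Hodge-correspondence images from lower
degrees lies in `N¹ H²ᵖ(X)`** (`e ≥ m + 1` gives codimension `≥ 1` on `X`).
[cite: Voisin2025, Prop. 4.8] -/
theorem hodgeCorrespondences_le_supportedClasses_of_hodgeConjecture (hHC : _root_.HodgeConjecture)
    {p : ℕ} {X : SchemeOver ℂ} (hX : IsSmoothProjective (2 * p) X) :
    (⨆ (μ : OrientationFamily) (m : ℕ) (Y : SchemeOver ℂ) (hY : IsSmoothProjective m Y)
        (a : ℕ) (e : ℕ) (hab : a + 2 * e = 2 * p + 2 * m) (_ : m + 1 ≤ e)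
        (κ : complexBetti (X ⊗ Y) (2 * e)) (_ : IsRationalClass κ)
        (_ : IsOfHodgeType (2 * p + m) (X ⊗ Y) (2 * e) e e κ),
        LinearMap.range (corrAction μ hX hY hab κ)) ≤ supportedClasses X (2 * p) 1 := by
  refine iSup_le fun μ ↦ iSup_le fun m ↦ iSup_le fun Y ↦ iSup_le fun hY ↦ iSup_le fun a ↦
    iSup_le fun e ↦ iSup_le fun hab ↦ iSup_le fun he ↦ iSup_le fun κ ↦ iSup_le fun hκ ↦
    iSup_le fun hκt ↦ ?_
  rintro _ ⟨c, rfl⟩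
  exact corrAction_mem_supportedClasses_of_hodgeConjecture hHC μ hX hY hab he hκ hκt c

/-! ### The registered assembly stub: the crux from `MiddleDivisorSupport` and Hodge effectivity -/

/-- **Stub `stub_transcendentalOrSupported_of_middle_of_hodgeEffective` of line `HodgeEffectivity`
(crux `TranscendentalOrSupported`, stmt-HodgeConjecture-10853) — the line's composition:
`MiddleDivisorSupport` (item 1081) and Hodge effectivity of the coniveau-1 phantom constituents of
`H²ᵖ(X^{2p})` (Voisin's Conj. 4.7 in Hodge-correspondence form, written out = the registered stub
`stub_hodgeEffective`) imply the crux.** The Hodge conjecture comes from `MiddleDivisorSupport`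
(`hodgeConjecture_of_middleDivisorSupport`); per `X` and model `A`, the landed induction engine
`isotypic_le_supportedClasses_of_ingredients` (p117181) is fed with semisimple splitting
(`stub_completelyReducible` + `smoothProjective_hodgeStructure_isPolarizable_holds`), Hodge lines
(`stub_rankOne`, supported by `MiddleDivisorSupport`), and phantoms: effectivity puts them in the
supremum of Hodge-correspondence images, which HC puts in `N¹`
(`hodgeCorrespondences_le_supportedClasses_of_hodgeConjecture`).
[cite: Voisin2025, Conj. 4.7 and Prop. 4.8] [cite: Thomas2005Nodes, Thm. 1] -/
theorem stub_transcendentalOrSupported_of_middle_of_hodgeEffective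
    (hMid : Summit.HodgeConjecture.HodgeConjecture.Theses.LinearSystemTorelli.MiddleDivisorSupport)
    (hEff : ∀ ⦃p : ℕ⦄ ⦃X : SchemeOver ℂ⦄, 1 ≤ p → ∀ (hX : IsSmoothProjective (2 * p) X)
      (A : HodgeModel (2 * p) X) (r : ℕ) (b : Fin r → complexBetti X (2 * p)),
      (∀ j, IsRationalClass (b j)) →
      (Submodule.span ℂ (Set.range b)).map (A.pullback (2 * p)).hom =
        ⨆ (p' : ℕ) (q' : ℕ) (_ : p' + q' = 2 * p),
          (Submodule.span ℂ (Set.range b)).map (A.pullback (2 * p)).hom ⊓ A.hodgePQ (2 * p) p' q' →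
      (Submodule.span ℂ (Set.range b)).map (A.pullback (2 * p)).hom ⊓ A.hodgePQ (2 * p) (2 * p) 0 = ⊥ →
      (∀ V : Submodule ℂ (complexBetti X (2 * p)), V ≤ Submodule.span ℂ (Set.range b) →
        Submodule.span ℂ {x : complexBetti X (2 * p) | x ∈ V ∧ IsRationalClass x} = V →
        V.map (A.pullback (2 * p)).hom =
          ⨆ (p' : ℕ) (q' : ℕ) (_ : p' + q' = 2 * p),
            V.map (A.pullback (2 * p)).hom ⊓ A.hodgePQ (2 * p) p' q' →
        V = ⊥ ∨ V = Submodule.span ℂ (Set.range b)) →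
      2 ≤ Module.finrank ℂ (Submodule.span ℂ (Set.range b)) →
      Submodule.span ℂ (Set.range b) ≤
        ⨆ (μ : OrientationFamily) (m : ℕ) (Y : SchemeOver ℂ) (hY : IsSmoothProjective m Y)
          (a : ℕ) (e : ℕ) (hab : a + 2 * e = 2 * p + 2 * m) (_ : m + 1 ≤ e)
          (κ : complexBetti (X ⊗ Y) (2 * e)) (_ : IsRationalClass κ)
          (_ : IsOfHodgeType (2 * p + m) (X ⊗ Y) (2 * e) e e κ),
          LinearMap.range (corrAction μ hX hY hab κ)) :
    Summit.HodgeConjecture.HodgeConjecture.Theses.LinearSystemTorelli.TranscendentalOrSupported := by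
  intro p X hp hX A r b hb hsub hbot j
  have hHC : _root_.HodgeConjecture := hodgeConjecture_of_middleDivisorSupport hMid
  exact isotypic_le_supportedClasses_of_ingredients hX A
    (stub_completelyReducible smoothProjective_hodgeStructure_isPolarizable_holds hX A (2 * p))
    (stub_rankOne hX A p) (fun w hw hwt ↦ hMid hp hX w hw ⟨A, hwt⟩)
    (fun r' b' hb' hsub' hbot' hirr' hge' ↦
      le_trans (hEff hp hX A r' b' hb' hsub' hbot' hirr' hge')
        (hodgeCorrespondences_le_supportedClasses_of_hodgeConjecture hHC hX))
    _ (isotypic_span_isRationalClass_inter_eq hb) hsub hbot (Submodule.subset_span ⟨j, rfl⟩)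

/-- **The strategist's three-hypothesis split glue** (`Lines/HodgeEffectivity_split.md`, children
`MiddleDivisorSupport` (1081), `PencilReduction` (1083), `HodgeEffective`): the crux from the three.
The `PencilReduction` hypothesis is now a theorem (`linearSystemTorelli_pencilReduction_proof`) and is
not used. [cite: Voisin2025, Prop. 4.8] -/
theorem TranscendentalOrSupported_of_subs
    (hMid : Summit.HodgeConjecture.HodgeConjecture.Theses.LinearSystemTorelli.MiddleDivisorSupport)
    (_hPR : Summit.HodgeConjecture.HodgeConjecture.Theses.LinearSystemTorelli.PencilReduction)
    (hEff : ∀ ⦃p : ℕ⦄ ⦃X : SchemeOver ℂ⦄, 1 ≤ p → ∀ (hX : IsSmoothProjective (2 * p) X)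
      (A : HodgeModel (2 * p) X) (r : ℕ) (b : Fin r → complexBetti X (2 * p)),
      (∀ j, IsRationalClass (b j)) →
      (Submodule.span ℂ (Set.range b)).map (A.pullback (2 * p)).hom =
        ⨆ (p' : ℕ) (q' : ℕ) (_ : p' + q' = 2 * p),
          (Submodule.span ℂ (Set.range b)).map (A.pullback (2 * p)).hom ⊓ A.hodgePQ (2 * p) p' q' →
      (Submodule.span ℂ (Set.range b)).map (A.pullback (2 * p)).hom ⊓ A.hodgePQ (2 * p) (2 * p) 0 = ⊥ →
      (∀ V : Submodule ℂ (complexBetti X (2 * p)), V ≤ Submodule.span ℂ (Set.range b) →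
        Submodule.span ℂ {x : complexBetti X (2 * p) | x ∈ V ∧ IsRationalClass x} = V →
        V.map (A.pullback (2 * p)).hom =
          ⨆ (p' : ℕ) (q' : ℕ) (_ : p' + q' = 2 * p),
            V.map (A.pullback (2 * p)).hom ⊓ A.hodgePQ (2 * p) p' q' →
        V = ⊥ ∨ V = Submodule.span ℂ (Set.range b)) →
      2 ≤ Module.finrank ℂ (Submodule.span ℂ (Set.range b)) →
      Submodule.span ℂ (Set.range b) ≤
        ⨆ (μ : OrientationFamily) (m : ℕ) (Y : SchemeOver ℂ) (hY : IsSmoothProjective m Y)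
          (a : ℕ) (e : ℕ) (hab : a + 2 * e = 2 * p + 2 * m) (_ : m + 1 ≤ e)
          (κ : complexBetti (X ⊗ Y) (2 * e)) (_ : IsRationalClass κ)
          (_ : IsOfHodgeType (2 * p + m) (X ⊗ Y) (2 * e) e e κ),
          LinearMap.range (corrAction μ hX hY hab κ)) :
    Summit.HodgeConjecture.HodgeConjecture.Theses.LinearSystemTorelli.TranscendentalOrSupported :=
  stub_transcendentalOrSupported_of_middle_of_hodgeEffective hMid hEff

/-! ### Tightness: the crux implies Hodge effectivity (modulo Deligne's Cor. 8.2.8) -/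

/-- **Push–pull for the graph of a morphism between two varieties** (Fulton §16.1): for
`g : Y ⟶ X` (`dim Y = m`, `dim X = n`) the Gysin image `γ = (g, 𝟙)₊ 1 ∈ H^{2n}((X ⊗ Y)(ℂ); ℂ)` of
`1 ∈ H⁰(Y(ℂ); ℂ)` under `lift g (𝟙 Y) : Y ⟶ X ⊗ Y` acts by `[γ]_* = g₊ ∘ (𝟙 Y)^*` (projection
formula `complexGysin_cup`, `∪ 1 = id`, `lift_snd`, functoriality `complexGysin_comp`, `lift_fst`).
[cite: Fulton1998, §16.1] -/
theorem corrAction_gysinGraph_one_two {μ : OrientationFamily} (hμ : μ.HasPoincareDuality) {n m : ℕ}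
    {X Y : SchemeOver ℂ} (hX : IsSmoothProjective n X) (hY : IsSmoothProjective m Y) (g : Y ⟶ X)
    {a b : ℕ} (hab : a + 2 * n = b + 2 * m) :
    corrAction μ hX hY hab
        (complexGysin μ hY (IsSmoothProjective.tensor_holds hX hY) (lift g (𝟙 Y))
          (show 0 + 2 * (n + m) = 2 * n + 2 * m by omega)
          (singularCohomology.one ℂ (ComplexPoints Y))) =
      complexGysin μ hY hX g hab ∘ₗ (complexBetti.map (𝟙 Y) a).hom := by
  have hXY := IsSmoothProjective.tensor_holds hX hY
  refine LinearMap.ext fun β ↦ ?_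
  rw [corrAction_apply, LinearMap.comp_apply,
    ← complexGysin_cup hμ hY hXY (lift g (𝟙 Y)) (Nat.add_zero a)
      (show a + 2 * (n + m) = a + 2 * n + 2 * m by omega)
      (show 0 + 2 * (n + m) = 2 * n + 2 * m by omega) rfl
      (complexBetti.map (snd X Y) a β) (singularCohomology.one ℂ (ComplexPoints Y)),
    cupProduct_one, ← CategoryTheory.comp_apply, ← complexBetti.map_comp, lift_snd,
    ← LinearMap.comp_apply (f := complexGysin μ hXY hX (fst X Y) _),
    ← complexGysin_comp hμ hY hXY hX (lift g (𝟙 Y)) (fst X Y)]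
  simp only [lift_fst]

/-- **TIGHTNESS: the crux implies Hodge effectivity, granted Deligne's Cor. 8.2.8** (the named fact
`Deligne1974_ker_restrictCompl_eq_iSup_range_complexGysin`, hypothesis `hD`, exactly as in
`stub_phantomGysin_of_transcendentalOrSupported`, p117363): the crux puts the span `W` of the `b j`
in `N¹ = G¹` (`residue_supportedClasses_le_iSupGysin`), and every Gysin image
`im (g₊ : Hᵃ(Y) → H²ᵖ(X))`, `dim Y = m < 2p`, IS the image of the Hodge correspondence
`κ = (g, 𝟙)₊ 1 ∈ H^{2·2p}((X ⊗ Y)(ℂ); ℂ)` — rational for the complex orientation family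
(`isRationalClass_complexGysin_complexOrientationFamily`, `isRationalClass_one`), of Hodge type
`(2p, 2p)` because algebraic (`complexGysin_mem_algebraicClasses`,
`isOfHodgeType_of_mem_algebraicClasses_of_isSmoothProjective`), from degree `a = 2m - 2p ≤ 2p - 2`
(`e = 2p ≥ m + 1`). So modulo one classical theorem `MiddleDivisorSupport ∧ HodgeEffective` IS the
crux, and `HodgeEffective` is the crux minus the Hodge conjecture. (Irreducibility, rank and the
`(2p,0)`-condition are carried, not used.)
[cite: Voisin2025, §4.2 (sentence before Conj. 4.7)] [cite: DeligneHodgeIII1974, Cor. 8.2.8] -/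
theorem hodgeEffective_of_transcendentalOrSupported
    (hD : Deligne1974_ker_restrictCompl_eq_iSup_range_complexGysin)
    (hT : Summit.HodgeConjecture.HodgeConjecture.Theses.LinearSystemTorelli.TranscendentalOrSupported) :
    ∀ ⦃p : ℕ⦄ ⦃X : SchemeOver ℂ⦄, 1 ≤ p → ∀ (hX : IsSmoothProjective (2 * p) X)
    (A : HodgeModel (2 * p) X) (r : ℕ) (b : Fin r → complexBetti X (2 * p)),
    (∀ j, IsRationalClass (b j)) →
    (Submodule.span ℂ (Set.range b)).map (A.pullback (2 * p)).hom =
      ⨆ (p' : ℕ) (q' : ℕ) (_ : p' + q' = 2 * p),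
        (Submodule.span ℂ (Set.range b)).map (A.pullback (2 * p)).hom ⊓ A.hodgePQ (2 * p) p' q' →
    (Submodule.span ℂ (Set.range b)).map (A.pullback (2 * p)).hom ⊓ A.hodgePQ (2 * p) (2 * p) 0 = ⊥ →
    (∀ V : Submodule ℂ (complexBetti X (2 * p)), V ≤ Submodule.span ℂ (Set.range b) →
      Submodule.span ℂ {x : complexBetti X (2 * p) | x ∈ V ∧ IsRationalClass x} = V →
      V.map (A.pullback (2 * p)).hom =
        ⨆ (p' : ℕ) (q' : ℕ) (_ : p' + q' = 2 * p),
          V.map (A.pullback (2 * p)).hom ⊓ A.hodgePQ (2 * p) p' q' →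
      V = ⊥ ∨ V = Submodule.span ℂ (Set.range b)) →
    2 ≤ Module.finrank ℂ (Submodule.span ℂ (Set.range b)) →
    Submodule.span ℂ (Set.range b) ≤
      ⨆ (μ : OrientationFamily) (m : ℕ) (Y : SchemeOver ℂ) (hY : IsSmoothProjective m Y)
        (a : ℕ) (e : ℕ) (hab : a + 2 * e = 2 * p + 2 * m) (_ : m + 1 ≤ e)
        (κ : complexBetti (X ⊗ Y) (2 * e)) (_ : IsRationalClass κ)
        (_ : IsOfHodgeType (2 * p + m) (X ⊗ Y) (2 * e) e e κ),
        LinearMap.range (corrAction μ hX hY hab κ) := by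
  intro p X hp hX A r b hb hsub hbot _ _
  have hN : Submodule.span ℂ (Set.range b) ≤ supportedClasses X (2 * p) 1 := by
    rw [Submodule.span_le]
    rintro _ ⟨j, rfl⟩
    exact hT hp hX A r b hb hsub hbot j
  refine hN.trans ((residue_supportedClasses_le_iSupGysin hD hX (2 * p)).trans ?_)
  refine iSup_le fun μ ↦ iSup_le fun m ↦ iSup_le fun hm ↦ iSup_le fun Y ↦ iSup_le fun hY ↦
    iSup_le fun g ↦ iSup_le fun a ↦ iSup_le fun hab ↦ ?_
  -- switch to the complex orientation family, whose Gysin maps preserve rationality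
  set ν : OrientationFamily := complexOrientationFamily with hν
  rw [range_complexGysin_eq_of_orientationFamily ν.hasPoincareDuality μ.hasPoincareDuality hY hX g hab]
  -- the graph class `κ = (g, 𝟙)₊ 1 ∈ H^{2·2p}(X ⊗ Y)`
  set κ : complexBetti (X ⊗ Y) (2 * (2 * p)) :=
    complexGysin ν hY (IsSmoothProjective.tensor_holds hX hY) (lift g (𝟙 Y))
      (show 0 + 2 * (2 * p + m) = 2 * (2 * p) + 2 * m by omega)
      (singularCohomology.one ℂ (ComplexPoints Y)) with hκ
  have hκrat : IsRationalClass κ :=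
    isRationalClass_complexGysin_complexOrientationFamily hY _ _ _ (isRationalClass_one _)
  have hκalg : κ ∈ algebraicClasses (X ⊗ Y) (2 * p) :=
    complexGysin_mem_supportedClasses (gysinMap_restrictCompl_eq_zero_of_field ℂ) ν
      ν.hasPoincareDuality hY (IsSmoothProjective.tensor_holds hX hY) (lift g (𝟙 Y)) _ (r := 0)
      (by omega) (by rw [supportedClasses_zero]; exact Submodule.mem_top)
  have hκt : IsOfHodgeType (2 * p + m) (X ⊗ Y) (2 * (2 * p)) (2 * p) (2 * p) κ :=
    isOfHodgeType_of_mem_algebraicClasses_of_isSmoothProjective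
      (IsSmoothProjective.tensor_holds hX hY) (2 * p) hκalg
  refine le_iSup_of_le ν (le_iSup_of_le m (le_iSup_of_le Y (le_iSup_of_le hY (le_iSup_of_le a
    (le_iSup_of_le (2 * p) (le_iSup_of_le hab (le_iSup_of_le (by omega) (le_iSup_of_le κ
    (le_iSup_of_le hκrat (le_iSup_of_le hκt ?_))))))))))
  rw [hκ, corrAction_gysinGraph_one_two ν.hasPoincareDuality hX hY g hab, complexBetti.map_id]
  rintro _ ⟨y, rfl⟩
  exact ⟨y, rfl⟩

end Summit.HodgeConjecture.HodgeConjecture.Theorems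

end
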